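import Mathlib.Analysis.Convex.Segment
import Mathlib.Analysis.Normed.Module.Convex
import Mathlib.Analysis.InnerProductSpace.Basic
import Summits.AtomisticToContinuum.HydrodynamicLimit.Theorems.InfluenceLocality.Negative.BushObjects
import HarnessLib

/-!
# `InfluenceLocality` (stmt-AtomisticToContinuum-13916) — bush separation (stub `stub_bushSeparation`, lead c4)

Line `ignition-cascade-refutation` (lead c4), Phase 2 (construction of `IgnitionTemplates`), architecture
"free lattice IFS top tree + bushes" (Cruxes/InfluenceLocality/Lines/ignition-cascade-refutation-c4.md §3).
The objects (`IsBush`, `bushEdge`, `bushElem`, `bushIdx`, `bushDepth`, `bushIncident`) are those of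
Negative/BushObjects.lean: a BUSH is a binary tree of free flights in `V3 = ℝ³` whose two children edges at every
node are perpendicular, of equal length `μ (k+1)` (`k` = depth of the node), sum to a positive multiple of the
incoming edge, and whose edge lengths decay by a factor `≤ ρ ≤ 1/4` per generation; words `w : List Bool` address
the nodes (head = last move), `(w, none)` is the node `pos w` and `(w, some b)` the closed edge
`[pos w, pos (b :: w)]`.

`stub_bushSeparation` is the purely geometric CLEARANCE LEMMA of such trees (no spheres, no dynamics):
(1) two admissible, non-incident elements are pointwise at distance at least `(2/3) · μ (max of their depths)`;
(2) every admissible element lies in the closed ball of radius `(4/3) · μ 1` about the root `pos []`.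

Proof (ball nesting; elementary inner-product algebra).
* `μ (n+1) ≤ μ n / 4`, so `μ` is antitone and, by the triangle inequality along the path, a descendant `v ++ d` of
  a node `d` is within `(4/3) · (μ (|d|+1) - μ (|d|+|v|+1)) ≤ (4/3) · μ (|d|+1) ≤ μ |d| / 3` of `pos d`; closed
  balls being convex, every element addressed at or below `d` lies in these balls (`IsBush.elem_ball`).
* Local geometry at a node `a` with children `cᵢ = pos (bᵢ :: a)`, `vᵢ = cᵢ - pos a`, `‖vᵢ‖ = μ`, `v₁ ⊥ v₂`:
  siblings are `√2 · μ ≥ (4/3) · μ` apart; a child is at distance `≥ μ` from every point of the sibling edge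
  (`‖θ • v₁ - v₂‖² = (1 + θ²) μ²`); and, when `a` is not the root, from every point of the INCOMING edge of `a`
  (`v₁ + v₂ = c • u`, `c > 0`, gives `⟪vᵢ, u⟫ = μ² / c ≥ 0`, hence `‖vᵢ + θ • u‖ ≥ μ` for `θ ≥ 0`).
* Case analysis on the two addresses (`suffix_trichotomy`): either one is an ancestor of the other — then the
  deeper element hangs below a child `d :: w` of the shallower address `w` and one of the three local facts at the
  pivot `w` (node / sibling edge) or at the pivot `b :: w` (incoming edge `[pos w, pos (b :: w)]`, the deeper element
  then hanging below a grandchild) combines with the `μ/3`-ball to give `≥ (2/3) · μ (pivot depth + 1)`; or they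
  diverge below a common ancestor `a` through different children, whose `μ/3`-balls are `(4/3 - 2/3) · μ` apart.
  In every case the pivot generation is at most the larger depth and `μ` is antitone.
Part (2) is the ball about the root (`d = []`). Design-independent; asserts no Theses decl.
-/

namespace Summit.AtomisticToContinuum.HydrodynamicLimit.Theorems.InfluenceLocality.Negative

open scoped InnerProductSpace
open Literature.MathematicalPhysics.KineticTheory

noncomputable section

/-! ## Words: suffix combinatorics (addresses grow at the head) -/

/-- A word of the form `y :: v ++ d` extends `d` through some child `x :: d` of `d`. -/
private lemma cons_append_suffix (y : Bool) (v d : List Bool) : ∃ x, (x :: d) <:+ (y :: v ++ d) := by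
  induction v generalizing y with
  | nil => exact ⟨y, List.suffix_refl _⟩
  | cons z v ih =>
    obtain ⟨x, hx⟩ := ih z
    exact ⟨x, hx.trans (List.suffix_cons _ _)⟩

/-- A strict ancestor `d` of `u` is an ancestor of `u` through one of its children `x :: d`. -/
private lemma exists_cons_suffix {d u : List Bool} (h : d <:+ u) (hne : d ≠ u) : ∃ x, (x :: d) <:+ u := by
  obtain ⟨v, rfl⟩ := h
  cases v with
  | nil => exact absurd (List.nil_append d).symm hne
  | cons y v => exact cons_append_suffix y v d

/-- Trichotomy of two addresses: one is an ancestor of the other, or they diverge below their nearest common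
ancestor `a` through two different children `b₁ :: a ≠ b₂ :: a`. -/
private lemma suffix_trichotomy (w w' : List Bool) :
    w <:+ w' ∨ w' <:+ w ∨
      ∃ (a : List Bool) (b₁ b₂ : Bool) (v₁ v₂ : List Bool), b₁ ≠ b₂ ∧ w = v₁ ++ b₁ :: a ∧ w' = v₂ ++ b₂ :: a := by
  induction w with
  | nil => exact Or.inl List.nil_suffix
  | cons z w₀ ih =>
    rcases ih with h | h | ⟨a, b₁, b₂, v₁, v₂, hb, h1, h2⟩
    · by_cases heq : w₀ = w'
      · subst heq
        exact Or.inr (Or.inl (List.suffix_cons _ _))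
      · obtain ⟨x, hx⟩ := exists_cons_suffix h heq
        by_cases hxz : x = z
        · subst hxz
          exact Or.inl hx
        · obtain ⟨v, hv⟩ := hx
          exact Or.inr (Or.inr ⟨w₀, z, x, [], v, fun h' => hxz h'.symm, rfl, hv.symm⟩)
    · exact Or.inr (Or.inl (h.trans (List.suffix_cons _ _)))
    · exact Or.inr (Or.inr ⟨a, b₁, b₂, z :: v₁, v₂, hb, by rw [h1]; rfl, h2⟩)

/-! ## The element bookkeeping -/

/-- Incidence is symmetric. -/
private lemma bushIncident_symm {e f : List Bool × Option Bool} (h : bushIncident e f) : bushIncident f e := by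
  rcases h with rfl | h
  · exact Or.inl rfl
  · refine Or.inr ?_
    obtain ⟨w, ob⟩ := e
    obtain ⟨w', ob'⟩ := f
    rcases ob with _ | b <;> rcases ob' with _ | b'
    · exact h
    · exact h
    · exact h
    · dsimp only at h ⊢
      rcases h with h | h | h
      · exact Or.inl h.symm
      · exact Or.inr (Or.inr h)
      · exact Or.inr (Or.inl h)

/-- Non-incident elements have different addresses. -/
private lemma fst_ne_of_not_incident {e f : List Bool × Option Bool} (h : ¬ bushIncident e f) : e.1 ≠ f.1 := by
  intro heq
  apply h
  obtain ⟨w, ob⟩ := e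
  obtain ⟨w', ob'⟩ := f
  dsimp only at heq
  subst heq
  rcases ob with _ | b <;> rcases ob' with _ | b' <;> simp [bushIncident]

/-- An element not incident to the edge into `b :: w` is not addressed at `b :: w`. -/
private lemma fst_ne_cons_of_not_incident {w : List Bool} {b : Bool} {f : List Bool × Option Bool}
    (h : ¬ bushIncident (w, some b) f) : f.1 ≠ b :: w := by
  intro heq
  apply h
  obtain ⟨w', ob'⟩ := f
  dsimp only at heq
  subst heq
  rcases ob' with _ | b' <;> simp [bushIncident]

/-- The address of an admissible element has length at most `K`. -/
private lemma length_le_of_idx {K : ℕ} {g : List Bool × Option Bool} (hg : bushIdx K g) : g.1.length ≤ K := by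
  rcases g with ⟨u, _ | b⟩
  · exact hg
  · exact Nat.le_of_lt hg

/-- The address of an element is no longer than its depth. -/
private lemma length_le_depth (g : List Bool × Option Bool) : g.1.length ≤ bushDepth g := by
  rcases g with ⟨u, _ | b⟩
  · exact le_rfl
  · exact Nat.le_succ _

/-! ## Elementary inner-product inequalities in `V3` -/

/-- Two orthogonal vectors of norm `m` are at distance `√2 · m ≥ (4/3) · m`. -/
private lemma norm_sub_ge_of_orth {u v : V3} {m : ℝ} (hu : ‖u‖ = m) (hv : ‖v‖ = m) (huv : ⟪u, v⟫_ℝ = 0) :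
    4 / 3 * m ≤ ‖u - v‖ := by
  have hm : 0 ≤ m := hu ▸ norm_nonneg u
  have h : (4 / 3 * m) ^ 2 ≤ ‖u - v‖ ^ 2 := by
    rw [norm_sub_sq_real, huv, hu, hv]
    nlinarith [sq_nonneg m]
  exact (sq_le_sq₀ (by positivity) (norm_nonneg _)).mp h

/-- For orthogonal `u`, `v` of norm `m`, every `θ • u` is at distance at least `m` from `v`. -/
private lemma norm_smul_sub_ge {u v : V3} {m : ℝ} (hu : ‖u‖ = m) (hv : ‖v‖ = m) (huv : ⟪u, v⟫_ℝ = 0) (θ : ℝ) :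
    m ≤ ‖θ • u - v‖ := by
  have hm : 0 ≤ m := hu ▸ norm_nonneg u
  have h : m ^ 2 ≤ ‖θ • u - v‖ ^ 2 := by
    rw [norm_sub_sq_real, norm_smul, real_inner_smul_left, huv, hv, hu, mul_pow]
    nlinarith [mul_nonneg (sq_nonneg ‖θ‖) (sq_nonneg m)]
  exact (sq_le_sq₀ hm (norm_nonneg _)).mp h

/-- If `⟪v, u⟫ ≥ 0` then moving from `v` along `u` does not decrease the norm below `‖v‖`. -/
private lemma norm_add_smul_ge {v u : V3} {m θ : ℝ} (hv : ‖v‖ = m) (hvu : 0 ≤ ⟪v, u⟫_ℝ) (hθ : 0 ≤ θ) :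
    m ≤ ‖v + θ • u‖ := by
  have hm : 0 ≤ m := hv ▸ norm_nonneg v
  have h : m ^ 2 ≤ ‖v + θ • u‖ ^ 2 := by
    rw [norm_add_sq_real, norm_smul, real_inner_smul_right, hv, mul_pow]
    nlinarith [mul_nonneg hθ hvu, mul_nonneg (sq_nonneg ‖θ‖) (sq_nonneg ‖u‖)]
  exact (sq_le_sq₀ hm (norm_nonneg _)).mp h

/-! ## Consequences of the bush axioms -/

variable {pos : List Bool → V3} {μ : ℕ → ℝ} {ρ : ℝ} {K : ℕ}

/-- Edge lengths shrink by a factor at least `4` per generation. -/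
private lemma IsBush.μ_quarter (hB : IsBush pos μ ρ K) (n : ℕ) : μ (n + 1) ≤ μ n / 4 := by
  have h1 := hB.μ_decay n
  have h2 : ρ * μ n ≤ 1 / 4 * μ n := mul_le_mul_of_nonneg_right hB.ρ_le (hB.μ_pos n).le
  linarith

/-- Edge lengths are antitone in the generation. -/
private lemma IsBush.μ_anti (hB : IsBush pos μ ρ K) {m n : ℕ} (h : m ≤ n) : μ n ≤ μ m := by
  have hA : Antitone μ := antitone_nat_of_succ_le fun k => by
    have := hB.μ_quarter k
    have := hB.μ_pos k
    linarith
  exact hA h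

/-- Monotonicity of the final bound in the depth. -/
private lemma IsBush.final (hB : IsBush pos μ ρ K) {j n : ℕ} {D : ℝ} (hj : j ≤ n) (h : 2 / 3 * μ j ≤ D) :
    2 / 3 * μ n ≤ D := by
  have := hB.μ_anti hj
  linarith

/-- PATH BOUND: a descendant `v ++ d` of the node `d` is within `(4/3) · (μ (|d|+1) - μ (|d|+|v|+1))` of it
(triangle inequality along the path plus `μ (n+1) ≤ μ n / 4`). -/
private lemma IsBush.dist_append_le (hB : IsBush pos μ ρ K) (v d : List Bool) (h : (v ++ d).length ≤ K) :
    dist (pos (v ++ d)) (pos d) ≤ 4 / 3 * (μ (d.length + 1) - μ (d.length + v.length + 1)) := by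
  induction v with
  | nil => simp
  | cons b v ih =>
    simp only [List.cons_append, List.length_cons] at h ⊢
    have hlt : (v ++ d).length < K := by omega
    have hq := hB.μ_quarter (d.length + v.length + 1)
    have hlen : (v ++ d).length = d.length + v.length := by rw [List.length_append, Nat.add_comm]
    have ih' := ih hlt.le
    calc dist (pos (b :: (v ++ d))) (pos d)
        ≤ dist (pos (b :: (v ++ d))) (pos (v ++ d)) + dist (pos (v ++ d)) (pos d) := dist_triangle _ _ _
      _ = μ (d.length + v.length + 1) + dist (pos (v ++ d)) (pos d) := by
          rw [dist_eq_norm, hB.norm_edge _ _ hlt, hlen]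
      _ ≤ 4 / 3 * (μ (d.length + 1) - μ (d.length + (v.length + 1) + 1)) := by
          rw [show d.length + (v.length + 1) + 1 = d.length + v.length + 1 + 1 from by ring]
          linarith

/-- BALL NESTING (nodes): a descendant `u` of the node `d` is within `(4/3) · μ (|d|+1)` of it. -/
private lemma IsBush.dist_le_of_suffix (hB : IsBush pos μ ρ K) {d u : List Bool} (h : d <:+ u)
    (hu : u.length ≤ K) : dist (pos u) (pos d) ≤ 4 / 3 * μ (d.length + 1) := by
  obtain ⟨v, rfl⟩ := h
  have h1 := hB.dist_append_le v d hu
  have h2 := hB.μ_pos (d.length + v.length + 1)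
  linarith

/-- BALL NESTING (elements): an admissible element addressed at or below the node `d` lies in the closed ball of
radius `(4/3) · μ (|d|+1)` about it (edges: both endpoints do, and closed balls are convex). -/
private lemma IsBush.elem_ball (hB : IsBush pos μ ρ K) {g : List Bool × Option Bool} {d : List Bool} {x : V3}
    (hg : bushIdx K g) (hd : d <:+ g.1) (hx : x ∈ bushElem pos g) :
    dist x (pos d) ≤ 4 / 3 * μ (d.length + 1) := by
  rcases g with ⟨u, _ | b⟩
  · have hx' : x = pos u := by simpa [bushElem] using hx
    subst hx'
    exact hB.dist_le_of_suffix hd hg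
  · have hx' : x ∈ segment ℝ (pos u) (pos (b :: u)) := by simpa [bushElem, bushEdge] using hx
    have hu : u.length < K := hg
    have h1 : pos u ∈ Metric.closedBall (pos d) (4 / 3 * μ (d.length + 1)) :=
      Metric.mem_closedBall.mpr (hB.dist_le_of_suffix hd hu.le)
    have h2 : pos (b :: u) ∈ Metric.closedBall (pos d) (4 / 3 * μ (d.length + 1)) :=
      Metric.mem_closedBall.mpr (hB.dist_le_of_suffix (hd.trans (List.suffix_cons b u)) (by simpa using hu))
    exact Metric.mem_closedBall.mp ((convex_closedBall _ _).segment_subset h1 h2 hx')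

/-- BALL NESTING, small form: the same element is within `μ |d| / 3` of `pos d`. -/
private lemma IsBush.elem_ball3 (hB : IsBush pos μ ρ K) {g : List Bool × Option Bool} {d : List Bool} {x : V3}
    (hg : bushIdx K g) (hd : d <:+ g.1) (hx : x ∈ bushElem pos g) : dist x (pos d) ≤ μ d.length / 3 := by
  have := hB.elem_ball hg hd hx
  have := hB.μ_quarter d.length
  linarith

/-- SIBLINGS are at distance `√2 · μ ≥ (4/3) · μ`. -/
private lemma IsBush.sibling (hB : IsBush pos μ ρ K) {a : List Bool} (ha : a.length < K) {b₁ b₂ : Bool}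
    (hb : b₁ ≠ b₂) : 4 / 3 * μ (a.length + 1) ≤ dist (pos (b₁ :: a)) (pos (b₂ :: a)) := by
  have key : 4 / 3 * μ (a.length + 1) ≤ dist (pos (true :: a)) (pos (false :: a)) := by
    rw [dist_eq_norm, ← sub_sub_sub_cancel_right (pos (true :: a)) (pos (false :: a)) (pos a)]
    exact norm_sub_ge_of_orth (hB.norm_edge a true ha) (hB.norm_edge a false ha) (hB.perp a ha)
  cases b₁ <;> cases b₂
  · exact absurd rfl hb
  · rwa [dist_comm]
  · exact key
  · exact absurd rfl hb

/-- A CHILD is at distance at least `μ` from the sibling edge `[pos a, pos (b :: a)]`. -/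
private lemma IsBush.child_edge (hB : IsBush pos μ ρ K) {a : List Bool} (ha : a.length < K) {b d : Bool}
    (hdb : d ≠ b) {x : V3} (hx : x ∈ segment ℝ (pos a) (pos (b :: a))) :
    μ (a.length + 1) ≤ dist x (pos (d :: a)) := by
  rw [segment_eq_image'] at hx
  obtain ⟨θ, -, rfl⟩ := hx
  have horth : ⟪pos (b :: a) - pos a, pos (d :: a) - pos a⟫_ℝ = 0 := by
    cases b <;> cases d
    · exact absurd rfl hdb
    · rw [real_inner_comm]; exact hB.perp a ha
    · exact hB.perp a ha
    · exact absurd rfl hdb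
  rw [dist_eq_norm]
  have : pos a + θ • (pos (b :: a) - pos a) - pos (d :: a) = θ • (pos (b :: a) - pos a) - (pos (d :: a) - pos a) := by
    abel
  rw [this]
  exact norm_smul_sub_ge (hB.norm_edge a b ha) (hB.norm_edge a d ha) horth θ

/-- A GRANDCHILD `d :: b₀ :: a₀` is at distance at least `μ` (its own edge length) from the incoming edge
`[pos a₀, pos (b₀ :: a₀)]` of its parent: the children point forward (`⟪vᵢ, u⟫ ≥ 0`). -/
private lemma IsBush.incoming_edge (hB : IsBush pos μ ρ K) {a₀ : List Bool} {b₀ : Bool}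
    (ha : (b₀ :: a₀).length < K) (d : Bool) {x : V3} (hx : x ∈ segment ℝ (pos a₀) (pos (b₀ :: a₀))) :
    μ ((b₀ :: a₀).length + 1) ≤ dist x (pos (d :: b₀ :: a₀)) := by
  obtain ⟨c, hc, hsum⟩ := hB.forward (b₀ :: a₀) b₀ a₀ rfl ha
  rw [segment_symm, segment_eq_image'] at hx
  obtain ⟨θ, hθ, rfl⟩ := hx
  have hinner : 0 ≤ ⟪pos (d :: b₀ :: a₀) - pos (b₀ :: a₀), pos (b₀ :: a₀) - pos a₀⟫_ℝ := by
    have h2 : 0 ≤ c * ⟪pos (d :: b₀ :: a₀) - pos (b₀ :: a₀), pos (b₀ :: a₀) - pos a₀⟫_ℝ := by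
      rw [← real_inner_smul_right, ← hsum, inner_add_right]
      cases d
      · have h0 := hB.perp (b₀ :: a₀) ha
        rw [real_inner_comm] at h0
        rw [h0, zero_add]
        exact real_inner_self_nonneg
      · rw [hB.perp (b₀ :: a₀) ha, add_zero]
        exact real_inner_self_nonneg
    exact (mul_nonneg_iff_of_pos_left hc).mp h2
  rw [dist_comm, dist_eq_norm]
  have : pos (d :: b₀ :: a₀) - (pos (b₀ :: a₀) + θ • (pos a₀ - pos (b₀ :: a₀))) =
      (pos (d :: b₀ :: a₀) - pos (b₀ :: a₀)) + θ • (pos (b₀ :: a₀) - pos a₀) := by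
    rw [smul_sub, smul_sub]
    abel
  rw [this]
  exact norm_add_smul_ge (hB.norm_edge _ d ha) hinner hθ.1

/-! ## Separation -/

/-- SEPARATION when the first address is an ancestor of the second. -/
private lemma IsBush.sep_of_suffix (hB : IsBush pos μ ρ K) {w : List Bool} {ob : Option Bool}
    {f : List Bool × Option Bool} (he : bushIdx K (w, ob)) (hf : bushIdx K f) (hne : ¬ bushIncident (w, ob) f)
    (hs : w <:+ f.1) {x y : V3} (hx : x ∈ bushElem pos (w, ob)) (hy : y ∈ bushElem pos f) :
    2 / 3 * μ (max (bushDepth (w, ob)) (bushDepth f)) ≤ dist x y := by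
  have hfK : f.1.length ≤ K := length_le_of_idx hf
  have hfD : f.1.length ≤ bushDepth f := length_le_depth f
  obtain ⟨d, hd⟩ := exists_cons_suffix hs (fst_ne_of_not_incident hne)
  have hdl : w.length + 1 ≤ f.1.length := by simpa using hd.length_le
  rcases ob with _ | b
  · -- a node against an element hanging strictly below it: through the child `d :: w`
    have hx' : x = pos w := by simpa [bushElem] using hx
    subst hx'
    have hwK : w.length < K := by omega
    have hyb : dist y (pos (d :: w)) ≤ μ (w.length + 1) / 3 := by simpa using hB.elem_ball3 hf hd hy
    have hed : dist (pos w) (pos (d :: w)) = μ (w.length + 1) := by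
      rw [dist_comm, dist_eq_norm, hB.norm_edge w d hwK]
    have key : 2 / 3 * μ (w.length + 1) ≤ dist (pos w) y := by
      have := dist_triangle (pos w) y (pos (d :: w))
      linarith
    exact hB.final (le_max_of_le_right (by omega)) key
  · -- an edge `[pos w, pos (b :: w)]` against an element hanging strictly below `w`
    have hx' : x ∈ segment ℝ (pos w) (pos (b :: w)) := by simpa [bushElem, bushEdge] using hx
    have hwK : w.length < K := he
    by_cases hdb : d = b
    · -- below the edge's own endpoint `b :: w`, hence below a grandchild `d' :: b :: w`
      rw [hdb] at hd
      obtain ⟨d', hd'⟩ := exists_cons_suffix hd (fst_ne_cons_of_not_incident hne).symm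
      have hdl' : w.length + 1 + 1 ≤ f.1.length := by simpa using hd'.length_le
      have hcK : (b :: w).length < K := by simp only [List.length_cons]; omega
      have hyb : dist y (pos (d' :: b :: w)) ≤ μ (w.length + 1 + 1) / 3 := by
        simpa only [List.length_cons] using hB.elem_ball3 hf hd' hy
      have hin : μ (w.length + 1 + 1) ≤ dist x (pos (d' :: b :: w)) := by
        simpa only [List.length_cons] using hB.incoming_edge hcK d' hx'
      have key : 2 / 3 * μ (w.length + 1 + 1) ≤ dist x y := by
        have := dist_triangle x y (pos (d' :: b :: w))
        linarith
      exact hB.final (le_max_of_le_right (by omega)) key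
    · -- below the sibling child `d :: w`, `d ≠ b`
      have hyb : dist y (pos (d :: w)) ≤ μ (w.length + 1) / 3 := by simpa using hB.elem_ball3 hf hd hy
      have hce : μ (w.length + 1) ≤ dist x (pos (d :: w)) := hB.child_edge hwK hdb hx'
      have key : 2 / 3 * μ (w.length + 1) ≤ dist x y := by
        have := dist_triangle x y (pos (d :: w))
        linarith
      exact hB.final (le_max_of_le_left le_rfl) key

/-- SEPARATION when the two addresses diverge below a common ancestor `a` (sibling balls). -/
private lemma IsBush.sep_of_diverge (hB : IsBush pos μ ρ K) {e f : List Bool × Option Bool}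
    (he : bushIdx K e) (hf : bushIdx K f) {a v₁ v₂ : List Bool} {b₁ b₂ : Bool} (hb : b₁ ≠ b₂)
    (h1 : e.1 = v₁ ++ b₁ :: a) (h2 : f.1 = v₂ ++ b₂ :: a) {x y : V3} (hx : x ∈ bushElem pos e)
    (hy : y ∈ bushElem pos f) : 2 / 3 * μ (max (bushDepth e) (bushDepth f)) ≤ dist x y := by
  have heK : e.1.length ≤ K := length_le_of_idx he
  have heD : e.1.length ≤ bushDepth e := length_le_depth e
  have hl : a.length + 1 ≤ e.1.length := by
    rw [h1, List.length_append, List.length_cons]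
    omega
  have haK : a.length < K := by omega
  have hxb : dist x (pos (b₁ :: a)) ≤ μ (a.length + 1) / 3 := by simpa using hB.elem_ball3 he ⟨v₁, h1.symm⟩ hx
  have hyb : dist y (pos (b₂ :: a)) ≤ μ (a.length + 1) / 3 := by simpa using hB.elem_ball3 hf ⟨v₂, h2.symm⟩ hy
  have hsib := hB.sibling haK hb
  have key : 2 / 3 * μ (a.length + 1) ≤ dist x y := by
    have := dist_triangle4 (pos (b₁ :: a)) x y (pos (b₂ :: a))
    rw [dist_comm] at hxb
    linarith
  exact hB.final (le_max_of_le_left (by omega)) key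

/-- STUB (bush separation, design-independent). In a bush of depth `K` with ratio `ρ ≤ 1/4`:
(1) two admissible, non-incident elements are at distance at least `(2/3) · μ (max of their depths)` pointwise;
(2) every admissible element lies in the closed ball of radius `(4/3) · μ 1` about the root `pos []`. -/
theorem stub_bushSeparation {pos : List Bool → V3} {μ : ℕ → ℝ} {ρ : ℝ} {K : ℕ}
    (hB : IsBush pos μ ρ K) :
    (∀ e f, bushIdx K e → bushIdx K f → ¬ bushIncident e f →
      ∀ x ∈ bushElem pos e, ∀ y ∈ bushElem pos f,
        (2 / 3 : ℝ) * μ (max (bushDepth e) (bushDepth f)) ≤ dist x y) ∧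
    (∀ e, bushIdx K e → ∀ x ∈ bushElem pos e, dist x (pos []) ≤ (4 / 3 : ℝ) * μ 1) := by
  refine ⟨fun e f he hf hne x hx y hy => ?_, fun e he x hx => ?_⟩
  · rcases suffix_trichotomy e.1 f.1 with hs | hs | ⟨a, b₁, b₂, v₁, v₂, hb, h1, h2⟩
    · obtain ⟨w, ob⟩ := e
      exact hB.sep_of_suffix he hf hne hs hx hy
    · obtain ⟨w', ob'⟩ := f
      have := hB.sep_of_suffix hf he (fun h => hne (bushIncident_symm h)) hs hy hx
      rwa [max_comm, dist_comm] at this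
    · exact hB.sep_of_diverge he hf hb h1 h2 hx hy
  · simpa using hB.elem_ball he List.nil_suffix hx

end

end Summit.AtomisticToContinuum.HydrodynamicLimit.Theorems.InfluenceLocality.Negative
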